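import Literature.NumberTheory.EllipticCurves.BurungaleSkinner2023.RationalThreeTorsionEngineProofs
import HarnessLib

/-!
# Burungale–Skinner 2023, Example (E3), part III: the conductors `44`, `50`, `106`
# (curve-side hypotheses of Thm. 2.8 KERNEL-CHECKED; Thms. 2.9 / 3.2 / 3.5 modulo the named facts)

A. Burungale, C. Skinner, Proc. AMS Ser. B 10 (2023), p. 22, Example (E3): "The elliptic curves
26.a2, 34.a3, 35.a2, 38.a2, 44.a2, 50.a2, 106c2 also have rational `3`-torsion points and satisfy the
hypotheses of Theorem 2.8." This part treats the two NON-semistable classes and conductor `106`, via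
the engine `RationalThreeTorsionEngineProofs` (decidable data: `3 ∤ Δ`, `ℓ₀ ∣ Δ`, `r_{ℓ₀} = 1`, the
additive proviso `ℓ₀ ∣ c₄ → ℓ₀ ≡ 2 (mod 3)`, a rational `T` with `2T = −T`). The conductors `44` and
`50` themselves are NOT computed (the additive exponents `f₂(44.a) = 2`, `f₅(50.a) = 2` would need
Tate's algorithm); the hypotheses only use the SUPPORT of `N` (`3 ∤ N`, `ℓ₀ ∣ N`), which the engine
reads off `Δ`:

* `44.a`: Cremona `44A1 = [0,1,0,3,−1]` (the only class of conductor `44`), `Δ = −2⁸·11`,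
  `c₄ = −2⁷` (ADDITIVE at `2`), `T = (1,2)`, `ℓ₀ = 2 ∈ A` with `2 ≡ −1 (mod 3)` — the additive
  branch of the hypothesis "`ℓ₀ ≡ −1 mod 3` if `ℓ₀ ∈ A`", as in (E2); (`ℓ₀ = 11`, `r₁₁ = 1`, would
  also do);
* `50.a`: Cremona `50A1 = [1,0,1,−1,−2]` (class `50.a`; `50.b` has `|E(ℚ)_{tors}| ∈ {5, 1}`),
  `Δ = −2·5⁴`, `c₄ = 5²` (additive at `5`, multiplicative at `2`), `T = (2,1)`, `ℓ₀ = 2`;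
* conductor `106`: Cremona `106A1 = [1,0,0,1,1]`, `Δ = −2³·53`, `c₄ = −47`, `N = 106`, `T = (0,1)`
  (`|E(ℚ)_{tors}| = 3`, Cremona's Table 1), `ℓ₀ = 2`. CAVEAT (faithfulness): the source prints the
  label "106c2"; of the four isogeny classes of conductor `106` Cremona's `106a` (`|T| = 3`) and
  `106c` both carry a `3`-isogeny, and the identification of the LMFDB class `106.c` with either is
  NOT verified here — what is certified is a conductor-`106` curve with a rational `3`-torsion point,
  which is all that Thm. 2.8's curve-side hypotheses see.

For each curve `c`: `posProportion_twists_c` / `infinitelyMany_twists_c` (Thm. 2.9 modulo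
`thm29_posProportion_twists_rankOne_nondegenerate`), `infinitelyMany_twists_c_pPartBSD` (Thm. 3.2
modulo `thm32_…`), `infinitelyMany_evenTwists_c_pPartBSD_rankZero` (Thm. 3.5 modulo `thm35_…`).
Definitions with bodies (models, points) + theorems; no new facts. Parts I/II: `26`, `34`, `35`, `38`.

References: [BurungaleSkinner2023] Example (E3) (p. 22), Thms. 2.8/2.9 (pp. 20–21), 3.2 (p. 25), 3.5
(p. 27); [CremonaAlgorithms1997] Table 1, `N = 44, 50, 106`; [SilvermanAEC2009] VII.1 Rem. 1.1,
VII.5 Prop. 5.1; [Silverman1994] IV.10.2.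
-/

noncomputable section

open scoped Classical

open NumberField IsDedekindDomain IsDedekindDomain.HeightOneSpectrum WeierstrassCurve Polynomial
  Literature.NumberTheory.EllipticCurves Literature.NumberTheory.EllipticCurves.Rank1Residual
  Literature.NumberTheory.QuadraticFields.Quadratic

namespace Literature.NumberTheory.EllipticCurves.BurungaleSkinner2023

/-! ### `44.a`: Cremona `44A1 = [0, 1, 0, 3, −1]` (additive at `2`) -/

section C44

/-- Cremona `44A1 = [0,1,0,3,−1]`, integer model (class `44.a` of (E3)).
[cite: CremonaAlgorithms1997, Table 1, N = 44, curve A1] -/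
abbrev M44a1 : WeierstrassCurve ℤ := ⟨0, 1, 0, 3, -1⟩

/-- `44A1 / ℚ`. [cite: CremonaAlgorithms1997, Table 1, N = 44, curve A1] -/
abbrev c44a1 : WeierstrassCurve ℚ := M44a1.baseChange ℚ

/-- `Δ(44A1) = −2816 = −2⁸·11`. [cite: CremonaAlgorithms1997, Table 1, N = 44] -/
theorem M44a1_Δ : M44a1.Δ = -2816 := by decide

/-- `c₄(44A1) = −128 = −2⁷` (so `2 ∣ Δ`, `2 ∣ c₄`: additive at `2`, `A = {2}`).
[cite: CremonaAlgorithms1997, Table 1, N = 44] -/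
theorem M44a1_c₄ : M44a1.c₄ = -128 := by decide

/-- `44A1` is an elliptic curve. [cite: CremonaAlgorithms1997, Table 1, N = 44] -/
theorem isElliptic_c44a1 : c44a1.IsElliptic := by
  rw [WeierstrassCurve.isElliptic_iff, baseChange_int_Δ, M44a1_Δ]; norm_num

/-- `44A1` is a global minimal equation (`|Δ| < 3¹²`, `2¹² ∤ Δ`). [cite: SilvermanAEC2009, VII.1 Remark 1.1] -/
theorem isGloballyMinimal_c44a1 : c44a1.IsGloballyMinimal :=
  isGloballyMinimal_baseChange_int M44a1 (forall_not_pow_dvd_or_of_bound M44a1 (B := 3)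
    (by rw [M44a1_Δ]; decide) (by rw [M44a1_Δ]; decide) (by rw [M44a1_Δ, M44a1_c₄]; decide))

/-- `44A1` is NOT multiplicative at `2` (additive: `2 ∣ Δ`, `2 ∣ c₄`), so `2 ∈ A` and the proviso
"`ℓ₀ ≡ −1 (mod 3)`" is in force for `ℓ₀ = 2` — and holds. [cite: SilvermanAEC2009, VII.5 Prop. 5.1(c)] -/
theorem not_hasMultiplicativeReductionAtPrime_c44a1_two :
    ¬ c44a1.HasMultiplicativeReductionAtPrime 2 := by
  haveI := isElliptic_c44a1
  exact not_hasMultiplicativeReductionAtPrime_baseChange_int_of_dvd_of_dvd M44a1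
    (by rw [M44a1_Δ]; decide) (by rw [M44a1_c₄]; decide)

/-- The coefficients of `44A1 / ℚ`. [cite: CremonaAlgorithms1997, Table 1, N = 44] -/
theorem c44a1_eq : c44a1 = ⟨0, 1, 0, 3, -1⟩ := by
  ext <;> simp [WeierstrassCurve.baseChange, WeierstrassCurve.map]

/-- The rational `3`-torsion point `T = (1, 2)` of `44A1` (`|E(ℚ)_{tors}| = 3`).
[cite: CremonaAlgorithms1997, Table 1, N = 44, curve A1 (|T| = 3)] -/
def T44a1 : c44a1.toAffine.Point :=
  Affine.Point.some 1 2 ((Affine.nonsingular_iff' _ _).mpr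
    ⟨(Affine.equation_iff _ _).mpr (by rw [c44a1_eq]; norm_num), Or.inr (by rw [c44a1_eq]; norm_num)⟩)

/-- `T + T = −T` on `44A1` (tangent slope `2` at `(1,2)`). [cite: CremonaAlgorithms1997, Table 1, N = 44] -/
theorem T44a1_add_self [DecidableEq ℚ] : T44a1 + T44a1 = -T44a1 := by
  have hy : (2 : ℚ) ≠ c44a1.toAffine.negY 1 2 := by rw [c44a1_eq]; norm_num [Affine.negY]
  unfold T44a1
  rw [Affine.Point.add_self_of_Y_ne hy, Affine.Point.neg_some]
  congr 1
  · rw [Affine.slope_of_Y_ne rfl hy, c44a1_eq]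
    norm_num [Affine.addX, Affine.negY]
  · rw [Affine.slope_of_Y_ne rfl hy, c44a1_eq]
    norm_num [Affine.addY, Affine.negAddY, Affine.addX, Affine.negY]

/-- `3·T̄ = O` in `E(ℚ̄)` for `44A1`. [cite: CremonaAlgorithms1997, Table 1, N = 44, curve A1 (|T| = 3)] -/
theorem three_nsmul_toGeomPoints_T44a1 : (3 : ℕ) • toGeomPoints c44a1 T44a1 = 0 := by
  have h3 : ∀ [DecidableEq ℚ], (3 : ℕ) • T44a1 = 0 := fun {_} => by
    rw [show (3 : ℕ) = 2 + 1 from rfl, add_nsmul, two_nsmul, one_nsmul, T44a1_add_self,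
      neg_add_cancel]
  have h := map_nsmul (Affine.Point.map (W' := c44a1.toAffine) (S := ℚ)
    (Algebra.ofId ℚ (AlgebraicClosure ℚ))) 3 T44a1
  rw [h3, map_zero] at h
  exact h.symm

/-- **Thm. 2.9 for `44.a` (`44A1`, `ℓ₀ = 2 ∈ A`, `2 ≡ −1 (mod 3)`)**, modulo
`thm29_posProportion_twists_rankOne_nondegenerate`: a positive proportion of imaginary quadratic
twists with `rank = ord_{s=1} L = 1`, `λ = 1` and NON-DEGENERATE `3`-adic height.
[cite: BurungaleSkinner2023, Thm. 2.9 (p. 21) with Example (E3) (p. 22)] -/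
theorem posProportion_twists_c44a1 (h : thm29_posProportion_twists_rankOne_nondegenerate) :
    haveI := isElliptic_c44a1
    haveI := isGloballyMinimal_c44a1
    OddQuadraticCharPosProportion fun d ↦ TwistConclusion c44a1 3 d := by
  haveI := isElliptic_c44a1
  haveI := isGloballyMinimal_c44a1
  exact posProportion_twists_of_intModel M44a1 (ℓ₀ := 2) (by rw [M44a1_Δ]; decide)
    (by rw [M44a1_Δ]; decide) (by rw [M44a1_Δ]; decide) (by rw [M44a1_Δ]; decide)
    numPrimesAbove_three_two (fun _ => by decide) T44a1 (Affine.Point.some_ne_zero _)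
    three_nsmul_toGeomPoints_T44a1 h

/-- **Infinitely many rank-one twists of `44A1` with non-degenerate `3`-adic height**, modulo Thm.
2.9 by name. [cite: BurungaleSkinner2023, Thm. 2.9 (p. 21) with Example (E3) (p. 22)] -/
theorem infinitelyMany_twists_c44a1 (h : thm29_posProportion_twists_rankOne_nondegenerate) :
    haveI := isElliptic_c44a1
    haveI := isGloballyMinimal_c44a1
    {d : ℤ | IsOddQuadraticCharDiscr d ∧ TwistConclusion c44a1 3 d}.Infinite :=
  (posProportion_twists_c44a1 h).infinite

/-- **Thm. 3.2 for `44.a`**, modulo `thm32_posProportion_twists_pPartBSD`.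
[cite: BurungaleSkinner2023, Thm. 3.2 (p. 25) with Example (E3) (p. 22)] -/
theorem infinitelyMany_twists_c44a1_pPartBSD (h : thm32_posProportion_twists_pPartBSD) :
    haveI := isElliptic_c44a1
    haveI := isGloballyMinimal_c44a1
    {d : ℤ | IsOddQuadraticCharDiscr d ∧ ((c44a1.quadraticTwist (d : ℚ)).analyticRank = 1 ∧
      ∀ (W' : WeierstrassCurve ℚ) [W'.IsElliptic] [W'.IsGloballyMinimal] (C : VariableChange ℚ),
        C • c44a1.quadraticTwist (d : ℚ) = W' → PPartRankOnePrintShape W' 3)}.Infinite := by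
  haveI := isElliptic_c44a1
  haveI := isGloballyMinimal_c44a1
  exact infinitelyMany_twists_pPartBSD_of_intModel M44a1 (ℓ₀ := 2) (by rw [M44a1_Δ]; decide)
    (by rw [M44a1_Δ]; decide) (by rw [M44a1_Δ]; decide) (by rw [M44a1_Δ]; decide)
    numPrimesAbove_three_two (fun _ => by decide) T44a1 (Affine.Point.some_ne_zero _)
    three_nsmul_toGeomPoints_T44a1 h

/-- **Thm. 3.5 for `44.a`**, modulo `thm35_posProportion_evenTwists_pPartBSD_rankZero`.
[cite: BurungaleSkinner2023, Thm. 3.5 (p. 27) with Example (E3) (p. 22)] -/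
theorem infinitelyMany_evenTwists_c44a1_pPartBSD_rankZero
    (h : thm35_posProportion_evenTwists_pPartBSD_rankZero) :
    haveI := isElliptic_c44a1
    haveI := isGloballyMinimal_c44a1
    {d : ℤ | IsEvenQuadraticCharDiscr d ∧ ((c44a1.quadraticTwist (d : ℚ)).entireLFunction 1 ≠ 0 ∧
      ∀ (W' : WeierstrassCurve ℚ) [W'.IsElliptic] [W'.IsGloballyMinimal] (C : VariableChange ℚ),
        C • c44a1.quadraticTwist (d : ℚ) = W' → PPartRankZeroPrintShape W' 3)}.Infinite := by
  haveI := isElliptic_c44a1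
  haveI := isGloballyMinimal_c44a1
  exact infinitelyMany_evenTwists_pPartBSD_rankZero_of_intModel M44a1 (ℓ₀ := 2)
    (by rw [M44a1_Δ]; decide) (by rw [M44a1_Δ]; decide) (by rw [M44a1_Δ]; decide)
    (by rw [M44a1_Δ]; decide) numPrimesAbove_three_two (fun _ => by decide) T44a1
    (Affine.Point.some_ne_zero _) three_nsmul_toGeomPoints_T44a1 h

end C44

/-! ### `50.a`: Cremona `50A1 = [1, 0, 1, −1, −2]` (additive at `5`, multiplicative at `2`) -/

section C50

/-- Cremona `50A1 = [1,0,1,−1,−2]`, integer model (class `50.a` of (E3)).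
[cite: CremonaAlgorithms1997, Table 1, N = 50, curve A1] -/
abbrev M50a1 : WeierstrassCurve ℤ := ⟨1, 0, 1, -1, -2⟩

/-- `50A1 / ℚ`. [cite: CremonaAlgorithms1997, Table 1, N = 50, curve A1] -/
abbrev c50a1 : WeierstrassCurve ℚ := M50a1.baseChange ℚ

/-- `Δ(50A1) = −1250 = −2·5⁴`. [cite: CremonaAlgorithms1997, Table 1, N = 50] -/
theorem M50a1_Δ : M50a1.Δ = -1250 := by decide

/-- `c₄(50A1) = 25 = 5²` (additive at `5`; `2 ∤ c₄`: multiplicative at `2`).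
[cite: CremonaAlgorithms1997, Table 1, N = 50] -/
theorem M50a1_c₄ : M50a1.c₄ = 25 := by decide

/-- `50A1` is an elliptic curve. [cite: CremonaAlgorithms1997, Table 1, N = 50] -/
theorem isElliptic_c50a1 : c50a1.IsElliptic := by
  rw [WeierstrassCurve.isElliptic_iff, baseChange_int_Δ, M50a1_Δ]; norm_num

/-- `50A1` is a global minimal equation (`|Δ| < 3¹²`). [cite: SilvermanAEC2009, VII.1 Remark 1.1] -/
theorem isGloballyMinimal_c50a1 : c50a1.IsGloballyMinimal :=
  isGloballyMinimal_baseChange_int M50a1 (forall_not_pow_dvd_or_of_bound M50a1 (B := 3)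
    (by rw [M50a1_Δ]; decide) (by rw [M50a1_Δ]; decide) (by rw [M50a1_Δ, M50a1_c₄]; decide))

/-- `50A1` is multiplicative at `ℓ₀ = 2` (`2 ∣ Δ`, `2 ∤ c₄`), so `2 ∉ A`.
[cite: SilvermanAEC2009, VII.5 Prop. 5.1(b)] -/
theorem hasMultiplicativeReductionAtPrime_c50a1_two : c50a1.HasMultiplicativeReductionAtPrime 2 := by
  haveI := isElliptic_c50a1
  exact hasMultiplicativeReductionAtPrime_baseChange_int_of_dvd_of_not_dvd M50a1
    (by rw [M50a1_Δ]; decide) (by rw [M50a1_c₄]; decide)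

/-- `50A1` is NOT multiplicative at `5` (additive: `5 ∣ Δ`, `5 ∣ c₄`; `A = {5}`).
[cite: SilvermanAEC2009, VII.5 Prop. 5.1(c)] -/
theorem not_hasMultiplicativeReductionAtPrime_c50a1_five [Fact (Nat.Prime 5)] :
    ¬ c50a1.HasMultiplicativeReductionAtPrime 5 := by
  haveI := isElliptic_c50a1
  exact not_hasMultiplicativeReductionAtPrime_baseChange_int_of_dvd_of_dvd M50a1
    (by rw [M50a1_Δ]; decide) (by rw [M50a1_c₄]; decide)

/-- The coefficients of `50A1 / ℚ`. [cite: CremonaAlgorithms1997, Table 1, N = 50] -/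
theorem c50a1_eq : c50a1 = ⟨1, 0, 1, -1, -2⟩ := by
  ext <;> simp [WeierstrassCurve.baseChange, WeierstrassCurve.map]

/-- The rational `3`-torsion point `T = (2, 1)` of `50A1` (`|E(ℚ)_{tors}| = 3`).
[cite: CremonaAlgorithms1997, Table 1, N = 50, curve A1 (|T| = 3)] -/
def T50a1 : c50a1.toAffine.Point :=
  Affine.Point.some 2 1 ((Affine.nonsingular_iff' _ _).mpr
    ⟨(Affine.equation_iff _ _).mpr (by rw [c50a1_eq]; norm_num), Or.inr (by rw [c50a1_eq]; norm_num)⟩)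

/-- `T + T = −T` on `50A1` (tangent slope `2` at `(2,1)`). [cite: CremonaAlgorithms1997, Table 1, N = 50] -/
theorem T50a1_add_self [DecidableEq ℚ] : T50a1 + T50a1 = -T50a1 := by
  have hy : (1 : ℚ) ≠ c50a1.toAffine.negY 2 1 := by rw [c50a1_eq]; norm_num [Affine.negY]
  unfold T50a1
  rw [Affine.Point.add_self_of_Y_ne hy, Affine.Point.neg_some]
  congr 1
  · rw [Affine.slope_of_Y_ne rfl hy, c50a1_eq]
    norm_num [Affine.addX, Affine.negY]
  · rw [Affine.slope_of_Y_ne rfl hy, c50a1_eq]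
    norm_num [Affine.addY, Affine.negAddY, Affine.addX, Affine.negY]

/-- `3·T̄ = O` in `E(ℚ̄)` for `50A1`. [cite: CremonaAlgorithms1997, Table 1, N = 50, curve A1 (|T| = 3)] -/
theorem three_nsmul_toGeomPoints_T50a1 : (3 : ℕ) • toGeomPoints c50a1 T50a1 = 0 := by
  have h3 : ∀ [DecidableEq ℚ], (3 : ℕ) • T50a1 = 0 := fun {_} => by
    rw [show (3 : ℕ) = 2 + 1 from rfl, add_nsmul, two_nsmul, one_nsmul, T50a1_add_self,
      neg_add_cancel]
  have h := map_nsmul (Affine.Point.map (W' := c50a1.toAffine) (S := ℚ)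
    (Algebra.ofId ℚ (AlgebraicClosure ℚ))) 3 T50a1
  rw [h3, map_zero] at h
  exact h.symm

/-- **Thm. 2.9 for `50.a` (`50A1`, `ℓ₀ = 2`)**, modulo `thm29_posProportion_twists_rankOne_nondegenerate`.
[cite: BurungaleSkinner2023, Thm. 2.9 (p. 21) with Example (E3) (p. 22)] -/
theorem posProportion_twists_c50a1 (h : thm29_posProportion_twists_rankOne_nondegenerate) :
    haveI := isElliptic_c50a1
    haveI := isGloballyMinimal_c50a1
    OddQuadraticCharPosProportion fun d ↦ TwistConclusion c50a1 3 d := by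
  haveI := isElliptic_c50a1
  haveI := isGloballyMinimal_c50a1
  exact posProportion_twists_of_intModel M50a1 (ℓ₀ := 2) (by rw [M50a1_Δ]; decide)
    (by rw [M50a1_Δ]; decide) (by rw [M50a1_Δ]; decide) (by rw [M50a1_Δ]; decide)
    numPrimesAbove_three_two (fun _ => by decide) T50a1 (Affine.Point.some_ne_zero _)
    three_nsmul_toGeomPoints_T50a1 h

/-- **Infinitely many rank-one twists of `50A1` with non-degenerate `3`-adic height**, modulo Thm.
2.9 by name. [cite: BurungaleSkinner2023, Thm. 2.9 (p. 21) with Example (E3) (p. 22)] -/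
theorem infinitelyMany_twists_c50a1 (h : thm29_posProportion_twists_rankOne_nondegenerate) :
    haveI := isElliptic_c50a1
    haveI := isGloballyMinimal_c50a1
    {d : ℤ | IsOddQuadraticCharDiscr d ∧ TwistConclusion c50a1 3 d}.Infinite :=
  (posProportion_twists_c50a1 h).infinite

/-- **Thm. 3.2 for `50.a`**, modulo `thm32_posProportion_twists_pPartBSD`.
[cite: BurungaleSkinner2023, Thm. 3.2 (p. 25) with Example (E3) (p. 22)] -/
theorem infinitelyMany_twists_c50a1_pPartBSD (h : thm32_posProportion_twists_pPartBSD) :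
    haveI := isElliptic_c50a1
    haveI := isGloballyMinimal_c50a1
    {d : ℤ | IsOddQuadraticCharDiscr d ∧ ((c50a1.quadraticTwist (d : ℚ)).analyticRank = 1 ∧
      ∀ (W' : WeierstrassCurve ℚ) [W'.IsElliptic] [W'.IsGloballyMinimal] (C : VariableChange ℚ),
        C • c50a1.quadraticTwist (d : ℚ) = W' → PPartRankOnePrintShape W' 3)}.Infinite := by
  haveI := isElliptic_c50a1
  haveI := isGloballyMinimal_c50a1
  exact infinitelyMany_twists_pPartBSD_of_intModel M50a1 (ℓ₀ := 2) (by rw [M50a1_Δ]; decide)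
    (by rw [M50a1_Δ]; decide) (by rw [M50a1_Δ]; decide) (by rw [M50a1_Δ]; decide)
    numPrimesAbove_three_two (fun _ => by decide) T50a1 (Affine.Point.some_ne_zero _)
    three_nsmul_toGeomPoints_T50a1 h

/-- **Thm. 3.5 for `50.a`**, modulo `thm35_posProportion_evenTwists_pPartBSD_rankZero`.
[cite: BurungaleSkinner2023, Thm. 3.5 (p. 27) with Example (E3) (p. 22)] -/
theorem infinitelyMany_evenTwists_c50a1_pPartBSD_rankZero
    (h : thm35_posProportion_evenTwists_pPartBSD_rankZero) :
    haveI := isElliptic_c50a1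
    haveI := isGloballyMinimal_c50a1
    {d : ℤ | IsEvenQuadraticCharDiscr d ∧ ((c50a1.quadraticTwist (d : ℚ)).entireLFunction 1 ≠ 0 ∧
      ∀ (W' : WeierstrassCurve ℚ) [W'.IsElliptic] [W'.IsGloballyMinimal] (C : VariableChange ℚ),
        C • c50a1.quadraticTwist (d : ℚ) = W' → PPartRankZeroPrintShape W' 3)}.Infinite := by
  haveI := isElliptic_c50a1
  haveI := isGloballyMinimal_c50a1
  exact infinitelyMany_evenTwists_pPartBSD_rankZero_of_intModel M50a1 (ℓ₀ := 2)
    (by rw [M50a1_Δ]; decide) (by rw [M50a1_Δ]; decide) (by rw [M50a1_Δ]; decide)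
    (by rw [M50a1_Δ]; decide) numPrimesAbove_three_two (fun _ => by decide) T50a1
    (Affine.Point.some_ne_zero _) three_nsmul_toGeomPoints_T50a1 h

end C50

/-! ### Conductor `106`: Cremona `106A1 = [1, 0, 0, 1, 1]` -/

section C106

/-- Cremona `106A1 = [1,0,0,1,1]`, integer model: a curve of conductor `106` with `|E(ℚ)_{tors}| = 3`
(Cremona's Table 1: `r = 0`, `|T| = 3`, Kodaira `I₃, I₁`, `3`-isogenous to `106A2`).
[cite: CremonaAlgorithms1997, Table 1, N = 106, curve A1] -/
abbrev M106a1 : WeierstrassCurve ℤ := ⟨1, 0, 0, 1, 1⟩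

/-- `106A1 / ℚ`. [cite: CremonaAlgorithms1997, Table 1, N = 106, curve A1] -/
abbrev c106a1 : WeierstrassCurve ℚ := M106a1.baseChange ℚ

/-- `Δ(106A1) = −424 = −2³·53`. [cite: CremonaAlgorithms1997, Table 1, N = 106 (ord Δ = 3, 1)] -/
theorem M106a1_Δ : M106a1.Δ = -424 := by decide

/-- `c₄(106A1) = −47`. [cite: CremonaAlgorithms1997, Table 1, N = 106] -/
theorem M106a1_c₄ : M106a1.c₄ = -47 := by decide

/-- `106A1` is an elliptic curve. [cite: CremonaAlgorithms1997, Table 1, N = 106] -/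
theorem isElliptic_c106a1 : c106a1.IsElliptic := by
  rw [WeierstrassCurve.isElliptic_iff, baseChange_int_Δ, M106a1_Δ]; norm_num

/-- `106A1` is a global minimal equation (`|Δ| < 2¹²`). [cite: SilvermanAEC2009, VII.1 Remark 1.1] -/
theorem isGloballyMinimal_c106a1 : c106a1.IsGloballyMinimal :=
  isGloballyMinimal_baseChange_int M106a1 (forall_not_pow_dvd_or_of_bound M106a1 (B := 2)
    (by rw [M106a1_Δ]; decide) (by rw [M106a1_Δ]; decide) (by rw [M106a1_Δ, M106a1_c₄]; decide))

/-- **`N(106A1) = 106 = 2·53`** (semistable). [cite: CremonaAlgorithms1997, Table 1, N = 106] -/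
theorem conductorNorm_c106a1 : c106a1.conductorNorm ℤ = 106 := by
  haveI := isElliptic_c106a1
  refine conductorNorm_baseChange_int_of_isCoprime M106a1
    (by rw [M106a1_Δ, M106a1_c₄, Int.isCoprime_iff_gcd_eq_one]; decide) (k := 3) ?_ ?_ ?_
  · rw [Nat.squarefree_iff_nodup_primeFactorsList (by norm_num)]; simp
  · rw [M106a1_Δ]; decide
  · rw [M106a1_Δ]; decide

/-- The coefficients of `106A1 / ℚ`. [cite: CremonaAlgorithms1997, Table 1, N = 106] -/
theorem c106a1_eq : c106a1 = ⟨1, 0, 0, 1, 1⟩ := by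
  ext <;> simp [WeierstrassCurve.baseChange, WeierstrassCurve.map]

/-- The rational `3`-torsion point `T = (0, 1)` of `106A1` (`|E(ℚ)_{tors}| = 3`).
[cite: CremonaAlgorithms1997, Table 1, N = 106, curve A1 (|T| = 3)] -/
def T106a1 : c106a1.toAffine.Point :=
  Affine.Point.some 0 1 ((Affine.nonsingular_iff' _ _).mpr
    ⟨(Affine.equation_iff _ _).mpr (by rw [c106a1_eq]; norm_num),
      Or.inr (by rw [c106a1_eq]; norm_num)⟩)

/-- `T + T = −T` on `106A1` (horizontal tangent at `(0,1)`). [cite: CremonaAlgorithms1997, Table 1, N = 106] -/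
theorem T106a1_add_self [DecidableEq ℚ] : T106a1 + T106a1 = -T106a1 := by
  have hy : (1 : ℚ) ≠ c106a1.toAffine.negY 0 1 := by rw [c106a1_eq]; norm_num [Affine.negY]
  unfold T106a1
  rw [Affine.Point.add_self_of_Y_ne hy, Affine.Point.neg_some]
  congr 1
  · rw [Affine.slope_of_Y_ne rfl hy, c106a1_eq]
    norm_num [Affine.addX, Affine.negY]
  · rw [Affine.slope_of_Y_ne rfl hy, c106a1_eq]
    norm_num [Affine.addY, Affine.negAddY, Affine.addX, Affine.negY]

/-- `3·T̄ = O` in `E(ℚ̄)` for `106A1`. [cite: CremonaAlgorithms1997, Table 1, N = 106, curve A1 (|T| = 3)] -/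
theorem three_nsmul_toGeomPoints_T106a1 : (3 : ℕ) • toGeomPoints c106a1 T106a1 = 0 := by
  have h3 : ∀ [DecidableEq ℚ], (3 : ℕ) • T106a1 = 0 := fun {_} => by
    rw [show (3 : ℕ) = 2 + 1 from rfl, add_nsmul, two_nsmul, one_nsmul, T106a1_add_self,
      neg_add_cancel]
  have h := map_nsmul (Affine.Point.map (W' := c106a1.toAffine) (S := ℚ)
    (Algebra.ofId ℚ (AlgebraicClosure ℚ))) 3 T106a1
  rw [h3, map_zero] at h
  exact h.symm

/-- **Thm. 2.9 for the conductor-`106` curve `106A1` (`ℓ₀ = 2`)**, modulo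
`thm29_posProportion_twists_rankOne_nondegenerate`. [cite: BurungaleSkinner2023, Thm. 2.9 (p. 21) with Example (E3) (p. 22)] -/
theorem posProportion_twists_c106a1 (h : thm29_posProportion_twists_rankOne_nondegenerate) :
    haveI := isElliptic_c106a1
    haveI := isGloballyMinimal_c106a1
    OddQuadraticCharPosProportion fun d ↦ TwistConclusion c106a1 3 d := by
  haveI := isElliptic_c106a1
  haveI := isGloballyMinimal_c106a1
  exact posProportion_twists_of_intModel M106a1 (ℓ₀ := 2) (by rw [M106a1_Δ]; decide)
    (by rw [M106a1_Δ]; decide) (by rw [M106a1_Δ]; decide) (by rw [M106a1_Δ]; decide)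
    numPrimesAbove_three_two (fun _ => by decide) T106a1 (Affine.Point.some_ne_zero _)
    three_nsmul_toGeomPoints_T106a1 h

/-- **Infinitely many rank-one twists of `106A1` with non-degenerate `3`-adic height**, modulo Thm.
2.9 by name. [cite: BurungaleSkinner2023, Thm. 2.9 (p. 21) with Example (E3) (p. 22)] -/
theorem infinitelyMany_twists_c106a1 (h : thm29_posProportion_twists_rankOne_nondegenerate) :
    haveI := isElliptic_c106a1
    haveI := isGloballyMinimal_c106a1
    {d : ℤ | IsOddQuadraticCharDiscr d ∧ TwistConclusion c106a1 3 d}.Infinite :=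
  (posProportion_twists_c106a1 h).infinite

/-- **Thm. 3.2 for `106A1`**, modulo `thm32_posProportion_twists_pPartBSD`.
[cite: BurungaleSkinner2023, Thm. 3.2 (p. 25) with Example (E3) (p. 22)] -/
theorem infinitelyMany_twists_c106a1_pPartBSD (h : thm32_posProportion_twists_pPartBSD) :
    haveI := isElliptic_c106a1
    haveI := isGloballyMinimal_c106a1
    {d : ℤ | IsOddQuadraticCharDiscr d ∧ ((c106a1.quadraticTwist (d : ℚ)).analyticRank = 1 ∧
      ∀ (W' : WeierstrassCurve ℚ) [W'.IsElliptic] [W'.IsGloballyMinimal] (C : VariableChange ℚ),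
        C • c106a1.quadraticTwist (d : ℚ) = W' → PPartRankOnePrintShape W' 3)}.Infinite := by
  haveI := isElliptic_c106a1
  haveI := isGloballyMinimal_c106a1
  exact infinitelyMany_twists_pPartBSD_of_intModel M106a1 (ℓ₀ := 2) (by rw [M106a1_Δ]; decide)
    (by rw [M106a1_Δ]; decide) (by rw [M106a1_Δ]; decide) (by rw [M106a1_Δ]; decide)
    numPrimesAbove_three_two (fun _ => by decide) T106a1 (Affine.Point.some_ne_zero _)
    three_nsmul_toGeomPoints_T106a1 h

/-- **Thm. 3.5 for `106A1`**, modulo `thm35_posProportion_evenTwists_pPartBSD_rankZero`.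
[cite: BurungaleSkinner2023, Thm. 3.5 (p. 27) with Example (E3) (p. 22)] -/
theorem infinitelyMany_evenTwists_c106a1_pPartBSD_rankZero
    (h : thm35_posProportion_evenTwists_pPartBSD_rankZero) :
    haveI := isElliptic_c106a1
    haveI := isGloballyMinimal_c106a1
    {d : ℤ | IsEvenQuadraticCharDiscr d ∧ ((c106a1.quadraticTwist (d : ℚ)).entireLFunction 1 ≠ 0 ∧
      ∀ (W' : WeierstrassCurve ℚ) [W'.IsElliptic] [W'.IsGloballyMinimal] (C : VariableChange ℚ),
        C • c106a1.quadraticTwist (d : ℚ) = W' → PPartRankZeroPrintShape W' 3)}.Infinite := by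
  haveI := isElliptic_c106a1
  haveI := isGloballyMinimal_c106a1
  exact infinitelyMany_evenTwists_pPartBSD_rankZero_of_intModel M106a1 (ℓ₀ := 2)
    (by rw [M106a1_Δ]; decide) (by rw [M106a1_Δ]; decide) (by rw [M106a1_Δ]; decide)
    (by rw [M106a1_Δ]; decide) numPrimesAbove_three_two (fun _ => by decide) T106a1
    (Affine.Point.some_ne_zero _) three_nsmul_toGeomPoints_T106a1 h

end C106

end Literature.NumberTheory.EllipticCurves.BurungaleSkinner2023

end
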